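import Literature.Topology.FourManifolds.SimplifiedBrokenLefschetzSidesGenus
import Literature.Topology.FourManifolds.SimplifiedBrokenLefschetzRoundCircle
import Literature.Topology.FourManifolds.DehnSurgeryUnknotZeroProofs
import HarnessLib

/-!
# The longitude of a genus-one SBLF is a submersion onto the circle

Helper `helper_sliceGluing_circleSubmersion` of the apex stub `stub_sliceGluing` of line `Sketch`,
crux `SblfDescent.RungOne` (crux item stmt-SmoothPoincare4-18531).

Let `f : X → S²` be a genus-one simplified broken Lefschetz fibration without Lefschetz points
(`IsSimplifiedBrokenLefschetzFibration o f ∅ 0`; Hayano 2011, Def. 2.1; Baykur–Kamada 2015, §3)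
on a closed `4`-manifold whose round image is the equator `sphereEquator 1 = {y₂ = 0}`.  The
*longitude* of `f` is the radial projection `x ↦ (f₀ x, f₁ x) / ‖(f₀ x, f₁ x)‖ ∈ S¹`
(`SurgeryUnknot.circleProj`), defined off the two poles.  We prove that it is a SUBMERSION at
every point `x` with `(f₀ x, f₁ x) ≠ 0`: this fibres a neighbourhood of the round circle over
`S¹` by `3`-dimensional pages, the first brick of the `S¹`-parametric fold normal form
(Baykur–Kamada 2015, §2 and §5 ¶1; Auroux–Donaldson–Katzarkov 2005, §8.1).

## Proof

Write `f x = (a, b, c)` with `(a, b) ≠ 0`, `T = (-b, a, 0)` (horizontal, orthogonal to `f x`)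
and `Λ(v) = -b v₀ + a v₁` on `ℝ²`, so that the height `⟪T, ·⟫ ∘ f` equals `Λ ∘ F` with
`F = (f₀, f₁) : X → ℝ²` the planar part of `f`.

* `d(⟪T, ·⟫ ∘ f)_x ≠ 0` (`mfderiv_tangentHeight_comp_ne_zero`).  At a regular point of `f` this
  is the chain rule (`not_isMCriticalPt_comp_of_surjective_mfderiv`, Milnor 1963, §2) together
  with the fact that the only critical points of a height `⟪T, ·⟫` on the sphere are `± T/‖T‖`
  (Milnor 1963, §6; the tree's `SphereHeight.coe_eq_or_eq_neg_of_isMCriticalPt`), which are not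
  orthogonal to `T`.  At a round point it is the tree's
  `not_isMCriticalPt_tangentHeight_comp_of_round` (Hayano 2011, Def. 2.1 (4): in a fold chart
  the round image is the axis, which `ψ⁻¹` carries onto the equator with non-zero speed).
* The planar germ `h = Λ ∘ coe ∘ circleProj`, `h(v) = Λ(v)/‖v‖` off the origin, has derivative
  `‖v₀‖⁻¹ Λ` at `v₀ = F x` (product rule, `Λ(v₀) = 0`).  Hence, by two chain rules,
  `‖v₀‖⁻¹ • d(Λ ∘ F)_x = d(h ∘ F)_x = d(Λ ∘ coe)_{g x} ∘ d(circleProj ∘ F)_x`, so the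
  differential of the longitude `circleProj ∘ F` at `x` is non-zero, i.e. onto the line `T S¹`
  (`Literature.Geometry.Manifold.surjective_mfderiv_sphereOne_iff_ne_zero`).

## References

* K. Hayano, *On genus-1 simplified broken Lefschetz fibrations*, Algebr. Geom. Topol. 11
  (2011), Def. 2.1 (4). [Hayano2011]
* R. İ. Baykur, S. Kamada, *Classification of broken Lefschetz fibrations with small fiber
  genera*, J. Math. Soc. Japan 67 (2015), §2, §5. [BaykurKamada2015]
* J. Milnor, *Morse theory* (1963), §2, §6. [Milnor1963]
-/

set_option linter.dupNamespace false

noncomputable section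

open scoped Manifold ContDiff Topology RealInnerProductSpace
open Set Function Literature.Topology.FourManifolds Literature.AlgebraicTopology.SingularHomology

namespace Summit.SmoothPoincare4.SmoothPoincare4.Cruxes.RungOne.Sketch

/-- Local notation: `𝔼 n` is the model Euclidean space `EuclideanSpace ℝ (Fin n)`. -/
local notation "𝔼 " n:arg => EuclideanSpace ℝ (Fin n)

/-- Local notation: `𝕊²`, the unit sphere of `ℝ³`. -/
local notation "𝕊²" => (Metric.sphere (0 : EuclideanSpace ℝ (Fin 3)) (1 : ℝ))

/-- Local notation: `𝕊¹`, the unit circle of `ℝ²`. -/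
local notation "𝕊¹" => (Metric.sphere (0 : EuclideanSpace ℝ (Fin 2)) (1 : ℝ))

attribute [local instance] Literature.Topology.FourManifolds.fact_finrank_euclideanSpace_succ

open SphereHeight SurgeryUnknot

/-- **The horizontal height is regular off the poles.**  At a point `y` of the sphere with
`(y₀, y₁) ≠ 0`, the height `⟪T, ·⟫` in the horizontal direction `T = (-y₁, y₀, 0)` orthogonal
to `y` has non-zero differential at `y`: the critical points of a height `⟪T, ·⟫`, `T ≠ 0`, are
`± T/‖T‖` (Milnor 1963, §6), and these are not orthogonal to `T`. [cite: Milnor1963, §6] -/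
theorem mfderiv_tangentHeight_ne_zero (y : 𝕊²)
    (hy : (y : 𝔼 3) 0 ≠ 0 ∨ (y : 𝔼 3) 1 ≠ 0) :
    mfderiv (𝓡 2) 𝓘(ℝ, ℝ)
      (height (WithLp.toLp 2 ![-(y : 𝔼 3) 1, (y : 𝔼 3) 0, 0] : 𝔼 3)) y ≠ 0 := by
  set T : 𝔼 3 := WithLp.toLp 2 ![-(y : 𝔼 3) 1, (y : 𝔼 3) 0, 0] with hT
  have hT0 : T ≠ 0 := by
    intro h
    have h0 := congrArg (fun v : 𝔼 3 => v 0) h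
    have h1 := congrArg (fun v : 𝔼 3 => v 1) h
    simp only [hT] at h0 h1
    simp at h0 h1
    exact hy.elim (fun h' => h' h1) (fun h' => h' h0)
  have horth : ⟪(y : 𝔼 3), T⟫ = 0 := by
    rw [BandFoliation.inner_eq_three]
    simp [hT]
    ring
  intro h0
  rcases coe_eq_or_eq_neg_of_isMCriticalPt (n := 2) hT0 (y := y) h0 with h | h
  · rw [h, real_inner_smul_left] at horth
    simp [hT0] at horth
  · rw [h, inner_neg_left, real_inner_smul_left] at horth
    simp [hT0] at horth

/-- **The horizontal height of `f` is regular near the round circle.**  For a genus-one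
Lefschetz-free SBLF `f` on a closed `X` with equatorial round image, at every point `x` with
`((f x)₀, (f x)₁) ≠ 0` the height `⟪T, ·⟫ ∘ f`, `T = (-(f x)₁, (f x)₀, 0)`, has non-zero
differential: at a regular point of `f` by the chain rule (Milnor 1963, §2) and
`mfderiv_tangentHeight_ne_zero`; at a round point by Hayano 2011, Def. 2.1 (4) (the tree's
`not_isMCriticalPt_tangentHeight_comp_of_round`). [cite: Hayano2011, Def. 2.1 (4)] -/
theorem mfderiv_tangentHeight_comp_ne_zero {X : Type*} [TopologicalSpace X]
    [ChartedSpace (𝔼 4) X] [IsManifold (𝓡 4) ∞ X]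
    {o : SmoothOrientation (𝓡 4) X} {f : X → 𝕊²}
    (hf : IsSimplifiedBrokenLefschetzFibration o f ∅ 0)
    (hC : f '' ({p : X | ¬ Surjective (mfderiv (𝓡 4) (𝓡 2) f p)} \ (↑(∅ : Finset X) : Set X)) =
      sphereEquator 1)
    (x : X) (hx : ((f x : 𝕊²) : 𝔼 3) 0 ≠ 0 ∨ ((f x : 𝕊²) : 𝔼 3) 1 ≠ 0) :
    mfderiv (𝓡 4) 𝓘(ℝ, ℝ)
      (height (WithLp.toLp 2 ![-((f x : 𝕊²) : 𝔼 3) 1, ((f x : 𝕊²) : 𝔼 3) 0, 0] : 𝔼 3) ∘ f)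
        x ≠ 0 := by
  by_cases hs : Surjective (mfderiv (𝓡 4) (𝓡 2) f x)
  · exact not_isMCriticalPt_comp_of_surjective_mfderiv
      ((hf.contMDiff x).mdifferentiableAt (by simp))
      ((contMDiff_height _ (f x)).mdifferentiableAt (by simp)) hs
      (mfderiv_tangentHeight_ne_zero (f x) hx)
  · exact hf.not_isMCriticalPt_tangentHeight_comp_of_round hC hs (by simp)

/-- **The longitude of a genus-one SBLF is a submersion onto the circle.**  For a genus-one
Lefschetz-free SBLF `f : X → S²` on a closed `X` with round image the equator `{y₂ = 0}`, the
radial projection `x ↦ ((f x)₀, (f x)₁)/‖((f x)₀, (f x)₁)‖ ∈ S¹` has onto differential at every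
point off the two polar fibres.  With `T = (-(f x)₁, (f x)₀, 0)` and `Λ(v) = -(f x)₁ v₀ + (f x)₀ v₁`
one has `⟪T, ·⟫ ∘ f = Λ ∘ (f₀, f₁)` with non-zero differential at `x`
(`mfderiv_tangentHeight_comp_ne_zero`; Hayano 2011, Def. 2.1 (4) at round points), while
`Λ ∘ coe ∘ circleProj = Λ/‖·‖` has derivative `‖v₀‖⁻¹ Λ` at `v₀ = ((f x)₀, (f x)₁)` (product
rule, `Λ v₀ = 0`); two chain rules then show that the differential of the longitude is non-zero,
i.e. onto the line `T S¹` (Baykur–Kamada 2015, §2: the fibration is a fibrewise handle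
attachment over the round circle). [cite: Hayano2011, Def. 2.1 (4)]
[cite: BaykurKamada2015, §2] -/
theorem helper_sliceGluing_circleSubmersion : ∀ (X : Type) [TopologicalSpace X] [T2Space X] [SecondCountableTopology X] [CompactSpace X] [ChartedSpace (𝔼 4) X] [IsManifold (𝓡 4) ∞ X] (o : SmoothOrientation (𝓡 4) X) (f : X → 𝕊²), IsSimplifiedBrokenLefschetzFibration o f ∅ 0 → f '' ({p : X | ¬ Surjective (mfderiv (𝓡 4) (𝓡 2) f p)} \ (↑(∅ : Finset X) : Set X)) = sphereEquator 1 → ∀ x : X, (((f x : 𝕊²) : 𝔼 3) 0 ≠ 0 ∨ ((f x : 𝕊²) : 𝔼 3) 1 ≠ 0) → Surjective (mfderiv (𝓡 4) (𝓡 1) (fun x' : X => SurgeryUnknot.circleProj ((EuclideanSpace.equiv (Fin 2) ℝ).symm ![((f x' : 𝕊²) : 𝔼 3) 0, ((f x' : 𝕊²) : 𝔼 3) 1])) x) := by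
  intro X _ _ _ _ _ _ o f hf hC x hx
  -- the planar part `F = (f₀, f₁)` of `f`
  set F : X → 𝔼 2 := fun x' => (EuclideanSpace.equiv (Fin 2) ℝ).symm
    ![((f x' : 𝕊²) : 𝔼 3) 0, ((f x' : 𝕊²) : 𝔼 3) 1] with hFdef
  show Surjective (mfderiv (𝓡 4) (𝓡 1) (fun x' : X => circleProj (F x')) x)
  have hF0 : ∀ x', F x' 0 = ((f x' : 𝕊²) : 𝔼 3) 0 := fun x' => by simp [hFdef]
  have hF1 : ∀ x', F x' 1 = ((f x' : 𝕊²) : 𝔼 3) 1 := fun x' => by simp [hFdef]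
  -- `F` is smooth
  have hcoe : ContMDiff (𝓡 4) 𝓘(ℝ, 𝔼 3) ∞ fun x' : X => ((f x' : 𝕊²) : 𝔼 3) :=
    contMDiff_coe_sphere.comp hf.contMDiff
  have hci : ∀ i : Fin 3, ContMDiff (𝓡 4) 𝓘(ℝ, ℝ) ∞ fun x' : X => ((f x' : 𝕊²) : 𝔼 3) i :=
    fun i => (contDiff_piLp_apply (p := 2) (i := i)).comp_contMDiff hcoe
  have hP : ContMDiff (𝓡 4) 𝓘(ℝ, Fin 2 → ℝ) ∞
      fun x' : X => ![((f x' : 𝕊²) : 𝔼 3) 0, ((f x' : 𝕊²) : 𝔼 3) 1] :=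
    contMDiff_pi_space.2 fun i => by
      fin_cases i
      · simpa using hci 0
      · simpa using hci 1
  have hFs : ContMDiff (𝓡 4) 𝓘(ℝ, 𝔼 2) ∞ F :=
    (EuclideanSpace.equiv (Fin 2) ℝ).symm.contDiff.comp_contMDiff hP
  -- the value `p = f x = (a, b, c)` with `(a, b) ≠ 0`
  obtain ⟨p, hp⟩ : ∃ p : 𝔼 3, ((f x : 𝕊²) : 𝔼 3) = p := ⟨_, rfl⟩
  have hx' : p 0 ≠ 0 ∨ p 1 ≠ 0 := hp ▸ hx
  have hFx0 : F x 0 = p 0 := by rw [hF0, hp]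
  have hFx1 : F x 1 = p 1 := by rw [hF1, hp]
  have hFx : F x ≠ 0 := by
    intro h0
    rw [h0] at hFx0 hFx1
    simp only [PiLp.zero_apply] at hFx0 hFx1
    exact hx'.elim (fun h => h hFx0.symm) (fun h => h hFx1.symm)
  -- the horizontal tangent `T = (-b, a, 0)` and the planar form `Λ v = -b v₀ + a v₁`
  set T : 𝔼 3 := WithLp.toLp 2 ![-p 1, p 0, 0] with hT
  set Λ : 𝔼 2 →L[ℝ] ℝ := (-p 1) • EuclideanSpace.proj (0 : Fin 2) +
    (p 0) • EuclideanSpace.proj (1 : Fin 2) with hΛdef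
  have hΛ : ∀ v : 𝔼 2, Λ v = -p 1 * v 0 + p 0 * v 1 := fun v => by simp [hΛdef]
  have hΛp : Λ (F x) = 0 := by rw [hΛ, hFx0, hFx1]; ring
  -- the height `⟪T, ·⟫ ∘ f = Λ ∘ F` has non-zero differential at `x`
  have hK : mfderiv (𝓡 4) 𝓘(ℝ, ℝ) (height T ∘ f) x ≠ 0 := by
    have h := mfderiv_tangentHeight_comp_ne_zero hf hC x hx
    rwa [hp] at h
  have hheight : height T ∘ f = fun x' => Λ (F x') := by
    funext x'
    rw [Function.comp_apply, height_apply, BandFoliation.inner_eq_three, hΛ, hF0, hF1]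
    simp [hT]
  have hFd : HasMFDerivAt (𝓡 4) 𝓘(ℝ, 𝔼 2) F x (mfderiv (𝓡 4) 𝓘(ℝ, 𝔼 2) F x) :=
    ((hFs x).mdifferentiableAt (by simp)).hasMFDerivAt
  set D := mfderiv (𝓡 4) 𝓘(ℝ, 𝔼 2) F x with hD
  have h1 : HasMFDerivAt (𝓡 4) 𝓘(ℝ, ℝ) (height T ∘ f) x (Λ.comp D) := by
    rw [hheight]
    exact Λ.hasFDerivAt.hasMFDerivAt.comp x hFd
  have hΛD : Λ.comp D ≠ 0 := fun h0 => hK (by rw [h1.mfderiv, h0]; rfl)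
  -- the planar germ `h = Λ ∘ coe ∘ circleProj = Λ / ‖·‖` off the origin
  set h : 𝔼 2 → ℝ := fun v => Λ ((circleProj v : 𝕊¹) : 𝔼 2) with hhdef
  have hnorm : DifferentiableAt ℝ (fun v : 𝔼 2 => ‖v‖⁻¹) (F x) :=
    ((contDiffAt_norm (n := 1) ℝ hFx).differentiableAt one_ne_zero).inv (norm_ne_zero_iff.2 hFx)
  have hh : HasFDerivAt h (‖F x‖⁻¹ • Λ) (F x) := by
    have h2 := hnorm.hasFDerivAt.mul Λ.hasFDerivAt
    rw [hΛp, zero_smul, add_zero] at h2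
    refine h2.congr_of_eventuallyEq ?_
    filter_upwards [isOpen_ne.mem_nhds hFx] with v hv
    show Λ ((circleProj v : 𝕊¹) : 𝔼 2) = ‖v‖⁻¹ * Λ v
    rw [coe_circleProj_eq_smul hv, map_smul, smul_eq_mul]
  -- first chain rule: `d(h ∘ F)_x = ‖F x‖⁻¹ • Λ ∘ dF_x`
  have h2 : HasMFDerivAt (𝓡 4) 𝓘(ℝ, ℝ) (h ∘ F) x ((‖F x‖⁻¹ • Λ).comp D) :=
    hh.hasMFDerivAt.comp x hFd
  -- second chain rule: `d(h ∘ F)_x = d(Λ ∘ coe)_{g x} ∘ d(circleProj ∘ F)_x`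
  have hGd : MDifferentiableAt (𝓡 4) (𝓡 1) (fun x' : X => circleProj (F x')) x :=
    ((contMDiffOn_circleProj.contMDiffAt (isOpen_ne.mem_nhds hFx)).comp x (hFs x))
      |>.mdifferentiableAt (by simp)
  have hΛS : MDifferentiableAt (𝓡 1) 𝓘(ℝ, ℝ) (fun u : 𝕊¹ => Λ (u : 𝔼 2))
      (circleProj (F x)) :=
    ((Λ.contDiff.comp_contMDiff (contMDiff_coe_sphere (m := 1))) _).mdifferentiableAt
      one_ne_zero
  have h3 : HasMFDerivAt (𝓡 4) 𝓘(ℝ, ℝ) (h ∘ F) x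
      ((mfderiv (𝓡 1) 𝓘(ℝ, ℝ) (fun u : 𝕊¹ => Λ (u : 𝔼 2)) (circleProj (F x))).comp
        (mfderiv (𝓡 4) (𝓡 1) (fun x' : X => circleProj (F x')) x)) := by
    have h3' := hΛS.hasMFDerivAt.comp x hGd.hasMFDerivAt
    exact h3'
  have hEq : (‖F x‖⁻¹ • Λ).comp D =
      (mfderiv (𝓡 1) 𝓘(ℝ, ℝ) (fun u : 𝕊¹ => Λ (u : 𝔼 2)) (circleProj (F x))).comp
        (mfderiv (𝓡 4) (𝓡 1) (fun x' : X => circleProj (F x')) x) := by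
    rw [← h2.mfderiv, h3.mfderiv]
  -- conclusion: the differential of the longitude is non-zero, hence onto the line `T S¹`
  refine (Literature.Geometry.Manifold.surjective_mfderiv_sphereOne_iff_ne_zero _ _).2 ?_
  intro h0
  apply hΛD
  have hc : ‖F x‖ ≠ 0 := norm_ne_zero_iff.2 hFx
  have h4 : (‖F x‖⁻¹ • Λ).comp D = 0 := by
    rw [hEq, h0, ContinuousLinearMap.comp_zero]
    rfl
  rw [show Λ.comp D = ‖F x‖ • ((‖F x‖⁻¹ • Λ).comp D) by
    rw [ContinuousLinearMap.smul_comp, smul_smul, mul_inv_cancel₀ hc, one_smul], h4, smul_zero]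

end Summit.SmoothPoincare4.SmoothPoincare4.Cruxes.RungOne.Sketch

end
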